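import Summits.ResolutionOfSingularities.ResolutionOfSingularities.Theorems.WeightedInvariantIotaOrderHusc
import Summits.ResolutionOfSingularities.ResolutionOfSingularities.Theorems.WeightedInvariantIota3EpsStratumRing
import Summits.ResolutionOfSingularities.ResolutionOfSingularities.Theorems.WeightedInvariantIota3TauStrat
import Summits.ResolutionOfSingularities.ResolutionOfSingularities.Theorems.WeightedInvariantIota3EpsStrat
import Literature.AlgebraicGeometry.Resolution.RegularLocusPerfectField
import HarnessLib

/-!
# (open″)≤3 for the pair of record `(ι₃ᵗ, J₃ᵗ)` — THE STRATUM IFF AT A CROSSING POINT: near a dimension-three position whose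
# top `ι₀`-stratum is the closed point and whose letter is `ε = 1`, the value `ι₃ᵗ(𝔪)` is attained at `𝔪` only
# (door `HypersurfaceCentreConstruction`, stmt-ResolutionOfSingularities-19897; P3 rung clause h8
# `JOpenPresentationForallSingLE 3 p Iota3.iotaFlatT Iota3.jFlatT`, point body (P₁₀) = (o52-Bε1) of res-L1-w43-plan-1's
# DEALER LINES #2 2026-08-27T18:06:55Z, hand res-L1-w43-stub-3)

Topic: `Summits/ResolutionOfSingularities/ResolutionOfSingularities/Theorems`. Helper for the door item
`HypersurfaceCentreConstruction` (stmt-ResolutionOfSingularities-19897, route `WeightedInvariant`), line `local-engine`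
(L W4.3), def-free.  The ι-SIDE of the CROSSING point body `JOpenLE3.PointBodyLE3 p 1 0` (res-D-brk-1's
`…JOpenPresentationLE3Defs`, p553420): at a model position `(A, 𝔪, F)` (`k` perfect, `A` of finite type, `A_𝔪` regular of
dimension `3`, `0 ≠ F/1 ∈ 𝔪² A_𝔪`) with `topStratumPrime ι₀ (A_𝔪) F = 𝔪 A_𝔪` and `ε(A_𝔪, F) = 1`, there is `h ∉ 𝔪` such that
for every prime `𝔮 ∌ h` of local dimension `≤ 3`:

    `𝔪 ≤ 𝔮 ↔ (F ∈ 𝔪_{A_𝔮}² ∧ ι₃ᵗ(A_𝔮) F = ι₃ᵗ(A_𝔪) F)`     (`exists_stratumIff_crossing`).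

ROUTE (no upper semicontinuity of `τ` or of the cylinder letter is needed).  Feed res-type-073's ABSTRACT SPECTRUM LEMMA
`StratumIff.stratumIff_of_strat` (p511396) with `v(𝔮) := iotaOrdEps (A_𝔮) F = (ν ; ε)`, `Sg(𝔮) := F ∈ 𝔪_{A_𝔮}²`, centre
`P := 𝔪`: (c7) for `(ν ; ε)` is res-type-013's `iotaOrdEps_generizationMonotone`; the superlevel sets in IDEAL FORM on the regular
basic open `D(h₀)` come from res-type-005's `husc_iotaOrd` (`{ν ≥ n} = V(I_n)`) and from res-type-047's reading of `ε` as the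
NON-REGULAR LOCUS of the reduced `ν`-stratum (`Iota3.iotaEps_eq_one_iff_not_isRegularLocalRing_quotient`,
`Iota3.isRegularLocalRing_quotient_map_iff`, …Iota3EpsStratumRing) together with «Reg of a finite-type algebra over a perfect field
is open» (Literature `isOpen_regularLocus_of_perfectField`):  `{(ν ; ε) ≥ (ν₀ ; 1)} = V(I_{ν₀+1} · J)`, `{(ν ; ε) > (ν₀ ; 1)} =
V(I_{ν₀+1})`, `J ⊇ √I_{ν₀}` the ideal of `Sing(A ⧸ √I_{ν₀})`; the (strat) input at `𝔪` is the hypothesis on the top `ι₀`-stratum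
(a generization with the same `(ν ; ε) = (ν₀ ; 1)` has `τ = 0` by res-type-013's `iotaTau_eq_zero_of_iotaEps_eq_one`, hence the
same `ι₀`).  Finally `ι₃ᵗ(𝔮) = ι₃ᵗ(𝔪) ⇒ (ν ; ε)(𝔮) = (ν₀ ; 1)` (`iotaFlatT_eq_iff`, `iotaOrdEpsTau_eq_iff`), and `𝔪 ≤ 𝔮` with
`dim A_𝔮 ≤ 3 = dim A_𝔪` forces `𝔮 = 𝔪` (heights).

* §1 `exists_not_mem_forall_le` (isolating `𝔪` among the primes over an ideal by a basic open; minimal primes),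
  `eq_of_le_of_ringKrullDim` (heights), `ringKrullDim_atPrime_le_of_le`, `iotaOrdEps_localization_mono` ((c7) for `(ν ; ε)` in `A`-form).
* §2 `exists_ideal_iotaEps_eq_one_iff` — `ε = 1` on the stratum `{ν = ν₀} ∩ D(h₀)` is `V(J)`.
* §3 **`exists_stratumIff_crossing`**.

[OURS · L1 W4.3 · (o52-Bε1)]  Replaces the role of NO printed item; NOT a statement of the manuscript
[claim: Hironaka2017, status: under-review]. AI work, weaker than expert review.  Pure commutative algebra; no named facts.

## References

* V. Cossart, O. Piltant, J. Algebra 320 (2008), Prop. 4.2 (proof) (generic behaviour of the order). [CossartPiltant2008]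
* H. Matsumura, *Commutative Ring Theory* (1987), §30 Cor. to Thm. 30.5 (regular locus), Thm. 13.5 (heights). [Matsumura1987]
* res-type-073 `…StratumIffOfStrat` (p511396), res-type-005 `…IotaOrderHusc`, res-type-047 `…Iota3EpsStratumRing`,
  res-type-013 `…Iota3EpsStrat` / `…Iota3TauStrat`, res-D-brk-1 `…JOpenPresentationLE3Defs` (OURS, AI work).
-/

noncomputable section

open IsLocalRing Literature.AlgebraicGeometry.Resolution
open Summit.ResolutionOfSingularities.ResolutionOfSingularities.Cruxes.HypersurfaceCentreConstruction.LocalEngine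
open Summit.ResolutionOfSingularities.ResolutionOfSingularities.Cruxes.HypersurfaceCentreConstruction.LocalEngine.Iota3

set_option linter.dupNamespace false -- mandated namespace of this single-conjunct summit

namespace Summit.ResolutionOfSingularities.ResolutionOfSingularities.Theorems

namespace CrossingPoint

variable {A : Type} [CommRing A]

/-! ## §1 Spectrum bookkeeping -/

/-- **Isolating `𝔪` over an ideal by a basic open**: if every prime `x` with `K ≤ x ≤ 𝔪` contains `𝔪`, then on some basic
open `D(h) ∋ 𝔪` every prime over `K` contains `𝔪` (avoid the finitely many minimal primes of `K` not inside `𝔪`).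
[cite: Matsumura1987, Thm. 6.5 (finitely many minimal primes)] -/
theorem exists_not_mem_forall_le [IsNoetherianRing A] (K 𝔪 : Ideal A) [𝔪.IsPrime]
    (hmin : ∀ x : Ideal A, x.IsPrime → K ≤ x → x ≤ 𝔪 → 𝔪 ≤ x) :
    ∃ h : A, h ∉ 𝔪 ∧ ∀ (𝔮 : Ideal A) [𝔮.IsPrime], h ∉ 𝔮 → K ≤ 𝔮 → 𝔪 ≤ 𝔮 := by
  classical
  have hfin : (K.minimalPrimes).Finite := Ideal.finite_minimalPrimes_of_isNoetherianRing A K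
  have hbadfin : {η ∈ K.minimalPrimes | ¬ η ≤ 𝔪}.Finite := hfin.subset fun η hη => hη.1
  have hchoice : ∀ η ∈ {η ∈ K.minimalPrimes | ¬ η ≤ 𝔪}, ∃ g : A, g ∈ η ∧ g ∉ 𝔪 := fun η hη =>
    SetLike.not_le_iff_exists.mp hη.2
  choose! g hg using hchoice
  refine ⟨∏ η ∈ hbadfin.toFinset, g η, ?_, fun 𝔮 _ hh𝔮 hK𝔮 => ?_⟩
  · intro hmem
    obtain ⟨η, hη, hgη⟩ := Ideal.IsPrime.prod_mem_iff.mp hmem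
    exact (hg η (hbadfin.mem_toFinset.mp hη)).2 hgη
  · obtain ⟨η, hηmin, hη𝔮⟩ := Ideal.exists_minimalPrimes_le hK𝔮
    by_cases hη𝔪 : η ≤ 𝔪
    · exact (hmin η hηmin.1.1 hηmin.1.2 hη𝔪).trans hη𝔮
    · exfalso
      apply hh𝔮
      have hηbad : η ∈ {η ∈ K.minimalPrimes | ¬ η ≤ 𝔪} := ⟨hηmin, hη𝔪⟩
      rw [← Finset.prod_erase_mul _ _ (hbadfin.mem_toFinset.mpr hηbad)]
      exact Ideal.mul_mem_left _ _ (hη𝔮 (hg η hηbad).1)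

/-- `dim A_x ≤ dim A_𝔪` for `x ≤ 𝔪` (heights). [cite: Matsumura1987, Thm. 13.5] -/
theorem ringKrullDim_atPrime_le_of_le {x 𝔪 : Ideal A} [x.IsPrime] [𝔪.IsPrime] (hle : x ≤ 𝔪) :
    ringKrullDim (Localization.AtPrime x) ≤ ringKrullDim (Localization.AtPrime 𝔪) := by
  rw [IsLocalization.AtPrime.ringKrullDim_eq_height x (Localization.AtPrime x),
    IsLocalization.AtPrime.ringKrullDim_eq_height 𝔪 (Localization.AtPrime 𝔪)]
  exact_mod_cast Ideal.height_mono hle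

/-- **A prime over `𝔪` of local dimension `≤ dim A_𝔪 < ∞` is `𝔪`** (a proper specialization raises the height).
[cite: Matsumura1987, Thm. 13.5] -/
theorem eq_of_le_of_ringKrullDim [IsNoetherianRing A] {𝔪 𝔮 : Ideal A} [𝔪.IsPrime] [𝔮.IsPrime] (hle : 𝔪 ≤ 𝔮) {d : ℕ}
    (h𝔪 : ringKrullDim (Localization.AtPrime 𝔪) = d) (h𝔮 : ringKrullDim (Localization.AtPrime 𝔮) ≤ d) : 𝔮 = 𝔪 := by
  by_contra hne
  have hlt : 𝔪 < 𝔮 := lt_of_le_of_ne hle (Ne.symm hne)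
  have h1 := Ideal.height_strict_mono_of_isPrime_of_isPrime hlt
  rw [IsLocalization.AtPrime.ringKrullDim_eq_height 𝔪 (Localization.AtPrime 𝔪)] at h𝔪
  rw [IsLocalization.AtPrime.ringKrullDim_eq_height 𝔮 (Localization.AtPrime 𝔮)] at h𝔮
  have h2 : ((𝔪.height : ℕ∞) : WithBot ℕ∞) < 𝔮.height := by exact_mod_cast h1
  rw [h𝔪] at h2
  exact lt_irrefl _ (h2.trans_le h𝔮)

/-- **(c7) for `(ν ; ε)` in `A`-form**: `iotaOrdEps` does not increase under generization among the primes of `A` with regular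
stalk (res-type-013's `iotaOrdEps_generizationMonotone` transported through `(A_{𝔮'})_{𝔮} ≃ A_𝔮`). [OURS · L1 W4.3] -/
theorem iotaOrdEps_localization_mono (F : A) (𝔮 𝔮' : Ideal A) [𝔮.IsPrime] [𝔮'.IsPrime] (hle : 𝔮 ≤ 𝔮')
    (hreg : IsRegularLocalRing (Localization.AtPrime 𝔮')) :
    iotaOrdEps (Localization.AtPrime 𝔮) (algebraMap A (Localization.AtPrime 𝔮) F) ≤
      iotaOrdEps (Localization.AtPrime 𝔮') (algebraMap A (Localization.AtPrime 𝔮') F) := by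
  obtain ⟨hprime, hcomap⟩ := StratumIff.isPrime_map_and_comap_map_eq 𝔮' 𝔮 hle
  haveI := hprime
  have h := iotaOrdEps_generizationMonotone (Localization.AtPrime 𝔮')
    (𝔮.map (algebraMap A (Localization.AtPrime 𝔮'))) (algebraMap A (Localization.AtPrime 𝔮') F)
  rwa [StratumIff.iota_localization_localization_eq iotaOrdEps iotaOrdEps_isoInvariant 𝔮' _ F,
    StratumIff.iota_localization_congr iotaOrdEps hcomap F] at h

/-! ## §2 `ε = 1` on the stratum `{ν = ν₀}` is a closed condition, in ideal form -/

/-- **`{ν = ν₀ ∧ ε = 1} ∩ D(h₀) = {ν = ν₀} ∩ V(J)`** for an ideal `J ⊇ I_{ν₀}`: on the regular basic open `D(h₀)`, if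
`{ν₀ ≤ ν} = V(I)` (ideal form of upper semicontinuity of the order, `husc`), then `J` := the ideal of the NON-REGULAR LOCUS of
`A ⧸ √I` works — `ε(A_𝔮, F) = 1` iff `A_𝔮 ⧸ √I A_𝔮 = (A ⧸ √I)_{𝔮}` is not regular (res-type-047), and `Reg(A ⧸ √I)` is open
(`k` perfect). [cite: Matsumura1987, §30 Cor. to Thm. 30.5] [OURS · L1 W4.3 · (o52-Bε1)] -/
theorem exists_ideal_iotaEps_eq_one_iff (k : Type) [Field k] [PerfectField k] [Algebra k A] [Algebra.FiniteType k A]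
    {h₀ : A} (hreg : ∀ (𝔮 : Ideal A) [𝔮.IsPrime], h₀ ∉ 𝔮 → IsRegularLocalRing (Localization.AtPrime 𝔮)) (F : A) (n : ℕ)
    {I : Ideal A} (hI : ∀ (𝔮 : Ideal A) [𝔮.IsPrime], h₀ ∉ 𝔮 →
      ((n : Ordinal) ≤ iotaOrd (Localization.AtPrime 𝔮) (algebraMap A (Localization.AtPrime 𝔮) F) ↔ I ≤ 𝔮)) :
    ∃ J : Ideal A, I ≤ J ∧ ∀ (𝔮 : Ideal A) [𝔮.IsPrime], h₀ ∉ 𝔮 →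
      iotaOrd (Localization.AtPrime 𝔮) (algebraMap A (Localization.AtPrime 𝔮) F) = n →
      (iotaEps (Localization.AtPrime 𝔮) (algebraMap A (Localization.AtPrime 𝔮) F) = 1 ↔ J ≤ 𝔮) := by
  classical
  -- the non-regular locus of `A ⧸ √I` is closed
  have hclosed : IsClosed (regularLocus (A ⧸ I.radical))ᶜ :=
    (isOpen_regularLocus_of_perfectField k (A ⧸ I.radical)).isClosed_compl
  obtain ⟨JB, hJB⟩ := (PrimeSpectrum.isClosed_iff_zeroLocus_ideal _).mp hclosed
  refine ⟨JB.comap (Ideal.Quotient.mk I.radical), ?_, fun 𝔮 _ h𝔮 hν => ?_⟩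
  · refine I.le_radical.trans ?_
    intro a ha
    rw [Ideal.mem_comap, Ideal.Quotient.eq_zero_iff_mem.mpr ha]
    exact zero_mem _
  · have hI'𝔮 : I.radical ≤ 𝔮 := by
      rw [Ideal.IsPrime.radical_le_iff inferInstance, ← hI 𝔮 h𝔮, hν]
    haveI := Iota3.isPrime_map_quotient_mk I.radical 𝔮 hI'𝔮
    -- the primes `q ≤ 𝔮` over `√I` are those where the order is kept
    have hJ : ∀ (q : Ideal A) [q.IsPrime], q ≤ 𝔮 →
        (I.radical ≤ q ↔ iotaOrd (Localization.AtPrime q) (algebraMap A (Localization.AtPrime q) F) =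
          iotaOrd (Localization.AtPrime 𝔮) (algebraMap A (Localization.AtPrime 𝔮) F)) := by
      intro q _ hq
      have hq₀ : h₀ ∉ q := fun h => h𝔮 (hq h)
      rw [Ideal.IsPrime.radical_le_iff inferInstance, ← hI q hq₀, hν]
      constructor
      · intro hle
        exact le_antisymm (hν ▸ StratumIff.iotaOrd_localization_mono F q 𝔮 hq (hreg 𝔮 h𝔮)) hle
      · intro heq
        rw [heq]
    rw [Iota3.iotaEps_eq_one_iff_not_isRegularLocalRing_quotient 𝔮 (Localization.AtPrime 𝔮) F I.radical
        (Ideal.radical_isRadical I) hJ,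
      Iota3.isRegularLocalRing_quotient_map_iff I.radical 𝔮 (Localization.AtPrime 𝔮) hI'𝔮]
    have hmem := Set.ext_iff.mp hJB ⟨𝔮.map (Ideal.Quotient.mk I.radical), inferInstance⟩
    rw [Set.mem_compl_iff, PrimeSpectrum.mem_zeroLocus] at hmem
    -- `hmem : ¬ (regular at 𝔮/√I) ↔ JB ⊆ 𝔮/√I`
    refine Iff.trans hmem ⟨fun hsub => ?_, fun hle => ?_⟩
    · intro a ha
      rw [Ideal.mem_comap] at ha
      have ha' : Ideal.Quotient.mk I.radical a ∈ 𝔮.map (Ideal.Quotient.mk I.radical) := hsub ha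
      rw [Ideal.mem_quotient_iff_mem_sup, sup_eq_left.mpr hI'𝔮] at ha'
      exact ha'
    · intro x hx
      obtain ⟨a, rfl⟩ := Ideal.Quotient.mk_surjective x
      exact Ideal.mem_map_of_mem _ (hle (Ideal.mem_comap.mpr hx))

/-! ## §3 The stratum iff at a crossing point -/

/-- **THE STRATUM IFF OF (open″)≤3 AT A CROSSING POINT.**  `k` perfect, `A` of finite type over `k`, `𝔪` a prime with `A_𝔪`
regular of dimension `3`, `F ∈ A` with `0 ≠ F/1 ∈ 𝔪² A_𝔪`, top `ι₀`-stratum of `(A_𝔪, F/1)` the closed point, `ε(A_𝔪, F/1) = 1`.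
Then some basic open `D(h) ∋ 𝔪` has: for every prime `𝔮 ∌ h` with `dim A_𝔮 ≤ 3`,
`𝔪 ≤ 𝔮 ↔ (F/1 ∈ 𝔪_{A_𝔮}² ∧ ι₃ᵗ(A_𝔮)(F) = ι₃ᵗ(A_𝔪)(F))`. [OURS · L1 W4.3 · (o52-Bε1)]
[cite: CossartPiltant2008, Prop. 4.2 (proof)] -/
theorem exists_stratumIff_crossing (k : Type) [Field k] [PerfectField k] [Algebra k A] [Algebra.FiniteType k A]
    (𝔪 : Ideal A) [𝔪.IsPrime] (F : A) (hreg : IsRegularLocalRing (Localization.AtPrime 𝔪))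
    (hdim : ringKrullDim (Localization.AtPrime 𝔪) = (3 : ℕ))
    (hF0 : algebraMap A (Localization.AtPrime 𝔪) F ≠ 0)
    (hF2 : algebraMap A (Localization.AtPrime 𝔪) F ∈ maximalIdeal (Localization.AtPrime 𝔪) ^ 2)
    (htop : ContactCylinder.topStratumPrime iotaOrdEpsTau (Localization.AtPrime 𝔪)
      (algebraMap A (Localization.AtPrime 𝔪) F) = maximalIdeal (Localization.AtPrime 𝔪))
    (hε : iotaEps (Localization.AtPrime 𝔪) (algebraMap A (Localization.AtPrime 𝔪) F) = 1) :
    ∃ h : A, h ∉ 𝔪 ∧ ∀ (𝔮 : Ideal A) [𝔮.IsPrime], h ∉ 𝔮 → ringKrullDim (Localization.AtPrime 𝔮) ≤ (3 : ℕ) →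
      (𝔪 ≤ 𝔮 ↔
        (algebraMap A (Localization.AtPrime 𝔮) F ∈ maximalIdeal (Localization.AtPrime 𝔮) ^ 2 ∧
          iotaFlatT (Localization.AtPrime 𝔮) (algebraMap A (Localization.AtPrime 𝔮) F) =
            iotaFlatT (Localization.AtPrime 𝔪) (algebraMap A (Localization.AtPrime 𝔪) F))) := by
  classical
  haveI : IsNoetherianRing A := Algebra.FiniteType.isNoetherianRing k A
  haveI := hreg
  have hdim' : ringKrullDim (Localization.AtPrime 𝔪) ≤ 3 := by rw [hdim]; exact le_of_eq (by norm_cast)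
  -- the order `ν₀` at `𝔪`
  obtain ⟨ν₀, hν₀⟩ := Ordinal.lt_omega0.mp (iotaOrd_lt_omega0_of_ne_zero (Localization.AtPrime 𝔪) hF0)
  have hτ𝔪 : iotaTau (Localization.AtPrime 𝔪) (algebraMap A (Localization.AtPrime 𝔪) F) = 0 :=
    iotaTau_eq_zero_of_iotaEps_eq_one hdim' hε
  -- the regular basic open and the ideals of the superlevel sets
  obtain ⟨h₀, hh₀, hreg₀⟩ := GenericEquimultiplicity.exists_not_mem_forall_isRegularLocalRing k 𝔪 hreg
  obtain ⟨I, hI⟩ := GenericEquimultiplicity.husc_iotaOrd k hreg₀ F ν₀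
  obtain ⟨I₁, hI₁⟩ := GenericEquimultiplicity.husc_iotaOrd k hreg₀ F (ν₀ + 1)
  obtain ⟨I₂, hI₂⟩ := GenericEquimultiplicity.husc_iotaOrd k hreg₀ F 2
  obtain ⟨J, hIJ, hJ⟩ := exists_ideal_iotaEps_eq_one_iff k hreg₀ F ν₀ hI
  -- `ν₀ < ν ↔ I₁ ≤ ·`
  have hlt_iff : ∀ (𝔮 : Ideal A) [𝔮.IsPrime], h₀ ∉ 𝔮 →
      ((ν₀ : Ordinal) < iotaOrd (Localization.AtPrime 𝔮) (algebraMap A (Localization.AtPrime 𝔮) F) ↔ I₁ ≤ 𝔮) := by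
    intro 𝔮 _ h𝔮
    rw [← hI₁ 𝔮 h𝔮, Nat.cast_succ, ← Order.succ_le_iff, Order.succ_eq_add_one]
  -- the abstract spectrum lemma, `v = (ν ; ε)`, `Sg = (F ∈ 𝔪²)`, centre `𝔪`
  obtain ⟨h, hh𝔪, hiff⟩ := StratumIff.stratumIff_of_strat
    (fun x : PrimeSpectrum A => iotaOrdEps (Localization.AtPrime x.asIdeal) (algebraMap A (Localization.AtPrime x.asIdeal) F))
    (fun x : PrimeSpectrum A =>
      algebraMap A (Localization.AtPrime x.asIdeal) F ∈ maximalIdeal (Localization.AtPrime x.asIdeal) ^ 2)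
    ⟨𝔪, inferInstance⟩ h₀ hh₀
    (fun x y hy hxy => iotaOrdEps_localization_mono F x.asIdeal y.asIdeal hxy (hreg₀ _ hy))
    ⟨I₁ * J, fun x hx => by
      change iotaOrdEps (Localization.AtPrime 𝔪) _ ≤ _ ↔ _
      rw [iotaOrdEps_le_iff, hν₀, hε, Ideal.IsPrime.mul_le inferInstance, ← hlt_iff x.asIdeal hx]
      constructor
      · rintro (hlt | ⟨heq, hle⟩)
        · exact Or.inl hlt
        · exact Or.inr ((hJ x.asIdeal hx heq.symm).mp (le_antisymm (iotaEps_le_one _ _) hle))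
      · rintro (hlt | hJx)
        · exact Or.inl hlt
        · have hν : (ν₀ : Ordinal) ≤ iotaOrd (Localization.AtPrime x.asIdeal) _ := (hI x.asIdeal hx).mpr (hIJ.trans hJx)
          rcases hν.lt_or_eq with hlt | heq
          · exact Or.inl hlt
          · exact Or.inr ⟨heq, le_of_eq ((hJ x.asIdeal hx heq.symm).mpr hJx).symm⟩⟩
    ⟨I₁, fun x hx => by
      change iotaOrdEps (Localization.AtPrime 𝔪) _ < _ ↔ _
      rw [show iotaOrdEps = iotaLex Ordinal.omega0 iotaOrd iotaEps from rfl, iotaLex_lt_iff iotaEps_boundedBy_omega0,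
        hν₀, hε, ← hlt_iff x.asIdeal hx]
      constructor
      · rintro (hlt | ⟨-, hlt1⟩)
        · exact hlt
        · exact absurd (iotaEps_le_one _ _) (not_le.mpr hlt1)
      · exact fun hlt => Or.inl hlt⟩
    ⟨I₂, fun x hx => by
      have h2 := hI₂ x.asIdeal hx
      rw [Nat.cast_ofNat] at h2
      exact (StratumIff.mem_sq_iff_two_le_iotaOrd F x.asIdeal).trans h2⟩
    (fun x y hy hxy hx => by
      have hx' := (StratumIff.mem_sq_iff_two_le_iotaOrd F x.asIdeal).mp hx
      exact (StratumIff.mem_sq_iff_two_le_iotaOrd F y.asIdeal).mpr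
        (hx'.trans (StratumIff.iotaOrd_localization_mono F _ _ hxy (hreg₀ _ hy))))
    ⟨𝔪, inferInstance⟩ le_rfl hF2
    (fun x hx𝔪 _ => by
      constructor
      · intro hv
        -- a generization with the same `(ν ; ε)` has `τ = 0`, hence the same `ι₀`: it lies in the top stratum
        haveI hregx : IsRegularLocalRing (Localization.AtPrime x.asIdeal) := hreg₀ _ fun hx => hh₀ (hx𝔪 hx)
        have hdimx : ringKrullDim (Localization.AtPrime x.asIdeal) ≤ 3 :=
          (ringKrullDim_atPrime_le_of_le hx𝔪).trans hdim'
        have hεx : iotaEps (Localization.AtPrime x.asIdeal) (algebraMap A (Localization.AtPrime x.asIdeal) F) = 1 :=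
          ((iotaOrdEps_eq_iff _ _ _ _).mp hv).2.trans hε
        have hτx := iotaTau_eq_zero_of_iotaEps_eq_one hdimx hεx
        have h0 : iotaOrdEpsTau (Localization.AtPrime x.asIdeal) (algebraMap A (Localization.AtPrime x.asIdeal) F) =
            iotaOrdEpsTau (Localization.AtPrime 𝔪) (algebraMap A (Localization.AtPrime 𝔪) F) :=
          (iotaOrdEpsTau_eq_iff _ _ _ _).mpr ⟨hv, hτx.trans hτ𝔪.symm⟩
        obtain ⟨hprime, hcomap⟩ := StratumIff.isPrime_map_and_comap_map_eq 𝔪 x.asIdeal hx𝔪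
        haveI := hprime
        have hmemtop : (⟨x.asIdeal.map (algebraMap A (Localization.AtPrime 𝔪)), hprime⟩ :
            PrimeSpectrum (Localization.AtPrime 𝔪)) ∈ ContactCylinder.topStratum iotaOrdEpsTau
              (Localization.AtPrime 𝔪) (algebraMap A (Localization.AtPrime 𝔪) F) := by
          rw [ContactCylinder.mem_topStratum_iff]
          change iotaOrdEpsTau (Localization.AtPrime (x.asIdeal.map (algebraMap A (Localization.AtPrime 𝔪)))) _ = _
          rw [StratumIff.iota_localization_localization_eq iotaOrdEpsTau iotaOrdEpsTau_isoInvariant 𝔪 _ F,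
            StratumIff.iota_localization_congr iotaOrdEpsTau hcomap F]
          exact h0
        have hle := ContactCylinder.topStratumPrime_le iotaOrdEpsTau (Localization.AtPrime 𝔪)
          (algebraMap A (Localization.AtPrime 𝔪) F) hmemtop
        rw [htop] at hle
        have hle' := Ideal.comap_mono (f := algebraMap A (Localization.AtPrime 𝔪)) hle
        have h𝔪eq : Ideal.comap (algebraMap A (Localization.AtPrime 𝔪)) (maximalIdeal (Localization.AtPrime 𝔪)) = 𝔪 :=
          IsLocalization.AtPrime.under_maximalIdeal (Localization.AtPrime 𝔪) 𝔪
        rw [h𝔪eq] at hle'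
        change 𝔪 ≤ (x.asIdeal.map (algebraMap A (Localization.AtPrime 𝔪))).comap _ at hle'
        rwa [hcomap] at hle'
      · intro h𝔪x
        have heq : x = ⟨𝔪, inferInstance⟩ := PrimeSpectrum.ext (le_antisymm hx𝔪 h𝔪x)
        subst heq
        rfl)
  refine ⟨h, hh𝔪, fun 𝔮 _ hh𝔮 hdim𝔮 => ?_⟩
  have hq := hiff ⟨𝔮, inferInstance⟩ hh𝔮
  constructor
  · intro hle
    have heq : 𝔮 = 𝔪 := eq_of_le_of_ringKrullDim hle hdim hdim𝔮
    subst heq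
    exact ⟨hF2, rfl⟩
  · rintro ⟨hSg, hflat⟩
    refine hq.mpr ⟨hSg, ?_⟩
    have h1 := ((iotaFlatT_eq_iff _ _ _ _).mp hflat).1
    exact ((iotaOrdEpsTau_eq_iff _ _ _ _).mp h1).1

end CrossingPoint

end Summit.ResolutionOfSingularities.ResolutionOfSingularities.Theorems

end
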